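import Literature.Geometry.Lorentzian.TeukolskyRadialSchrodingerForm
import Literature.Geometry.Lorentzian.TeukolskyInfinityNormalisedLimits
import Literature.Geometry.Lorentzian.KerrSeparatedPotentialBounds
import Literature.Geometry.Lorentzian.KerrTortoiseRadius
import Literature.Analysis.ODE.SoninEnvelope
import HarnessLib

/-!
# Far envelope of the infinity-normalised scalar radial solution `R_{𝓘⁺}`:
# `(r² + a²)|R_𝓘|² ≤ 4` and `|u_𝓘′|² ≤ 2ω²` for `r ≥ max(7M, √(12Λ)/|ω|, 1/(Mω²))`

(namespace `Literature.Geometry.Lorentzian.Kerr.Costa2019`; a bridge lemma toward the cone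
Green-kernel bound for the scalar radial Teukolsky pair of R. Teixeira da Costa,
arXiv:1910.02854, Def. 2.3.)

For `0 < M`, `|a| < M`, `ω ≠ 0`, an admissible frequency triple `(ω, m, Λ)`
(`Kerr.IsAdmissibleTriple`, DRSR Def. 6.1.1), a classical solution `R` of the scalar (`s = 0`)
radial Teukolsky ODE with `λ = Λ − a²ω²` (`Kerr.IsRadialTeukolskySolution`) normalised at `𝓘⁺`
(`Kerr.IsNormalisedInfinitySolution M 0 ω R`), and every radius
`r ≥ R₀ := max(7M, √(12Λ)/|ω|, 1/(Mω²))`, we prove (`Costa2019.farEnergy_le`,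
`Costa2019.farEnvelope`)

  `(ω² − V(r))·(r² + a²)|R(r)|² + (Δ/(r² + a²))² |d/dr[(r² + a²)^{1/2} R](r)|² ≤ 2ω²`,
  `(r² + a²)|R(r)|² ≤ 4`,  `(Δ/(r² + a²))² |d/dr[(r² + a²)^{1/2} R](r)|² ≤ 2ω²`,

i.e. `Φ|u_𝓘|² + |u_𝓘′|² ≤ 2ω²`, `|u_𝓘|² ≤ 4`, `|u_𝓘′|² ≤ 2ω²` for `u_𝓘 = (r² + a²)^{1/2} R_𝓘`,
`′ = d/dr* = (Δ/(r² + a²)) d/dr`, `Φ = ω² − V`, `V = Kerr.sepPotential M a ω m Λ`.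

The argument is the Sonin–Pólya energy in the (decrease) region of
Dafermos–Rodnianski–Shlapentokh-Rothman (arXiv:1402.7034, §8.4): along a tortoise radius
function `ρ` (`Kerr.IsTortoiseRadius`, `dρ/dx = Δ/(ρ² + a²)`), `u = (ρ² + a²)^{1/2} R ∘ ρ`
solves Carter's equation `u″ + (ω² − V(ρ x)) u = 0` (`Kerr.schrodingerForm`). On `r ≥ R₀`:
`dV/dr < 0` (`Kerr.deriv_sepPotential_neg_of_seven_mul_le`, since `R₀ ≥ 7M`) and
`|V| ≤ 3Λ/r² + 3M/r³ ≤ ω²/4 + ω²/4` (`Kerr.abs_sepPotential_le`, since `r²ω² ≥ 12Λ` and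
`r³ω² ≥ 49M`), so `Φ = ω² − V ≥ ω²/2` increases along `r*`; hence the energy
`E = Φ|u|² + |u′|²`, `E′ = Φ′|u|² ≥ 0` (`Literature.Analysis.ODE.hasDerivAt_soninEnergy`), is
non-decreasing on `[x₀, ∞)` (`ρ x₀ = r`) and therefore bounded by its limit
`ω²·1 + ω² = 2ω²` at `r* = +∞` (`Costa2019.tendsto_norm_infinitySolution`: `|u| → 1`,
`Costa2019.tendsto_norm_deriv_infinitySolution`: `|u′| → |ω|`, and `V → 0`). At `x₀`:
`(ω²/2)|u|² ≤ Φ|u|² ≤ 2ω²` and `|u′|² ≤ 2ω²`. Everything is proved; theorems only.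

## References
* M. Dafermos, I. Rodnianski, Y. Shlapentokh-Rothman, *Decay for solutions of the wave equation
  on Kerr exterior spacetimes III*, arXiv:1402.7034 = Ann. of Math. 183 (2016): §5.2.3 (Carter's
  equation), §8.4, proof of Prop. 8.4.1 ((someBoundS), (decrease)).
  [DafermosRodnianskiShlapentokhrothman2014]
* R. Teixeira da Costa, *Mode stability for the Teukolsky equation on extremal and subextremal
  Kerr spacetimes*, CMP 378 (2020) 705–781 = arXiv:1910.02854: Def. 2.3 (`R_{𝓘⁺}`). [Costa2019]
-/

noncomputable section

open Filter Set Topology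

namespace Literature.Geometry.Lorentzian.Kerr

namespace Costa2019

/-! ### A non-decreasing function is bounded by its limit at `+∞` -/

/-- If `E` has a nonnegative derivative on `[x₀, ∞)` and `E → L` at `+∞`, then `E(x₀) ≤ L`
(`E` is non-decreasing on `[x₀, ∞)`, so `E(x₀) ≤ E(y)` eventually, and limits preserve `≤`).
[folklore] -/
private theorem le_lim_of_deriv_nonneg {E E' : ℝ → ℝ} {x₀ L : ℝ}
    (hE : ∀ y, x₀ ≤ y → HasDerivAt E (E' y) y) (hE' : ∀ y, x₀ ≤ y → 0 ≤ E' y)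
    (hL : Tendsto E atTop (𝓝 L)) : E x₀ ≤ L := by
  have hmono : MonotoneOn E (Ici x₀) := by
    refine monotoneOn_of_deriv_nonneg (convex_Ici x₀)
      (fun y hy ↦ (hE y hy).continuousAt.continuousWithinAt)
      (fun y hy ↦ (hE y (interior_subset hy)).differentiableAt.differentiableWithinAt) ?_
    intro y hy
    have hy' : x₀ ≤ y := interior_subset (s := Ici x₀) hy
    rw [(hE y hy').deriv]
    exact hE' y hy'
  refine ge_of_tendsto hL ?_
  filter_upwards [eventually_ge_atTop x₀] with y hy
  exact hmono self_mem_Ici hy hy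

/-! ### The far region `r ≥ max(7M, √(12Λ)/|ω|, 1/(Mω²))`: `r > r₊`, `ω² − V ≥ ω²/2`, `dV/dr < 0` -/

/-- On `t ≥ max(7M, √(12Λ)/|ω|, 1/(Mω²))` (`0 < M`, `|a| < M`, `ω ≠ 0`, admissible triple):
`t > r₊` (`r₊ = M + √(M² − a²) ≤ 2M`), `ω² − V(t) ≥ ω²/2` (from (someBoundS) in the form
`|V| ≤ 3Λ/t² + 3M/t³` of `Kerr.abs_sepPotential_le`, with `t²ω² ≥ 12Λ` and
`t³ω² ≥ 49M ≥ 12M`), and `dV/dt < 0` ((decrease) with `R_dec = 7M`,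
`Kerr.deriv_sepPotential_neg_of_seven_mul_le`). DRSR arXiv:1402.7034, §8.4.
[cite: DafermosRodnianskiShlapentokhrothman2014, Prop. 8.4.1 (proof)] -/
private theorem far_region {M a ω Λ : ℝ} {m : ℤ} (hM : 0 < M) (ha : |a| < M) (hω : ω ≠ 0)
    (hadm : IsAdmissibleTriple a ω m Λ) {t : ℝ}
    (ht : max (7 * M) (max (Real.sqrt (12 * Λ) / |ω|) (1 / (M * ω ^ 2))) ≤ t) :
    rPlus M a < t ∧ ω ^ 2 / 2 ≤ ω ^ 2 - sepPotential M a ω m Λ t ∧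
      deriv (sepPotential M a ω m Λ) t < 0 := by
  have h7 : 7 * M ≤ t := le_of_max_le_left ht
  have hΛt : Real.sqrt (12 * Λ) / |ω| ≤ t := le_of_max_le_left (le_of_max_le_right ht)
  have hMt : 1 / (M * ω ^ 2) ≤ t := le_of_max_le_right (le_of_max_le_right ht)
  have ht0 : 0 < t := by linarith
  have hω0 : 0 < |ω| := abs_pos.2 hω
  have hω2 : 0 < ω ^ 2 := by positivity
  -- `r₊ = M + √(M² − a²) ≤ 2M < 7M ≤ t`
  have hrp : rPlus M a < t := by
    have h1 : Real.sqrt (M ^ 2 - a ^ 2) ≤ M := by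
      rw [Real.sqrt_le_left hM.le]
      nlinarith [sq_nonneg a]
    unfold rPlus
    linarith
  refine ⟨hrp, ?_, deriv_sepPotential_neg_of_seven_mul_le ha hadm h7⟩
  -- `3Λ/t² ≤ ω²/4`: `12Λ = (√(12Λ))² ≤ (t|ω|)² = t²ω²`
  have hΛ : 0 ≤ Λ := hadm.nonneg
  have h1 : Real.sqrt (12 * Λ) ≤ t * |ω| := by rwa [div_le_iff₀ hω0] at hΛt
  have h2 : 12 * Λ ≤ t ^ 2 * ω ^ 2 := by
    have h3 : Real.sqrt (12 * Λ) ^ 2 ≤ (t * |ω|) ^ 2 :=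
      pow_le_pow_left₀ (Real.sqrt_nonneg _) h1 2
    rwa [Real.sq_sqrt (by positivity), mul_pow, sq_abs] at h3
  have hA : 3 * Λ / t ^ 2 ≤ ω ^ 2 / 4 := by
    rw [div_le_iff₀ (by positivity)]
    linarith
  -- `3M/t³ ≤ ω²/4`: `tMω² ≥ 1` and `t² ≥ 49M²` give `M·t³ω² ≥ t² ≥ 49M²`, `t³ω² ≥ 49M`
  have h4 : 1 ≤ t * (M * ω ^ 2) := by rwa [div_le_iff₀ (by positivity)] at hMt
  have h5 : 49 * M ≤ ω ^ 2 * t ^ 3 := by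
    have h6 : M * (49 * M) ≤ M * (ω ^ 2 * t ^ 3) := by
      have h7' : 49 * M ^ 2 ≤ t ^ 2 := by nlinarith
      have h8 : t ^ 2 * 1 ≤ t ^ 2 * (t * (M * ω ^ 2)) :=
        mul_le_mul_of_nonneg_left h4 (sq_nonneg t)
      nlinarith
    exact le_of_mul_le_mul_left h6 hM
  have hB : 3 * M / t ^ 3 ≤ ω ^ 2 / 4 := by
    rw [div_le_iff₀ (by positivity)]
    nlinarith
  have hV := (le_abs_self _).trans (abs_sepPotential_le hM ha.le hadm hrp.le)
  linarith

/-! ### Along a tortoise radius: `V(ρ x) → 0`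

(A tortoise radius function takes every value `r > r₊`: that is the public
`Costa2019.tortoise_exists_eq` of `TeukolskyWhitingEndgame.lean`, used directly below.) -/

/-- `V(ρ x) → 0` as `x → +∞` along a tortoise radius function (`|V| ≤ 3Λ/r² + 3M/r³` on
`r ≥ r₊`, `Kerr.abs_sepPotential_le`, and `ρ → ∞`). DRSR arXiv:1402.7034, §8.4 (someBoundS).
[cite: DafermosRodnianskiShlapentokhrothman2014, §8.4] -/
private theorem tendsto_sepPotential_tortoise {M a ω Λ : ℝ} {m : ℤ} (hM : 0 < M) (ha : |a| < M)
    (hadm : IsAdmissibleTriple a ω m Λ) {ρ : ℝ → ℝ} (hρ : IsTortoiseRadius M a ρ) :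
    Tendsto (fun x ↦ sepPotential M a ω m Λ (ρ x)) atTop (𝓝 0) := by
  have hb : Tendsto (fun x ↦ 3 * Λ / ρ x ^ 2 + 3 * M / ρ x ^ 3) atTop (𝓝 0) := by
    have h2 := (tendsto_pow_atTop two_ne_zero).comp hρ.tendsto_atTop
    have h3 := (tendsto_pow_atTop three_ne_zero).comp hρ.tendsto_atTop
    have h := ((tendsto_const_nhds (x := 3 * Λ)).div_atTop h2).add
      ((tendsto_const_nhds (x := 3 * M)).div_atTop h3)
    rw [add_zero] at h
    exact h
  refine squeeze_zero_norm (fun x ↦ ?_) hb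
  rw [Real.norm_eq_abs]
  exact abs_sepPotential_le hM ha.le hadm (hρ.rPlus_lt x).le

/-! ### The Sonin energy bound in the far region -/

/-- **Far Sonin-energy bound for `R_{𝓘⁺}`.** For `0 < M`, `|a| < M`, `ω ≠ 0`, an admissible
triple `(ω, m, Λ)`, a classical solution `R` of the scalar radial Teukolsky ODE
(`λ = Λ − a²ω²`) normalised at `𝓘⁺` (TdC Def. 2.3), and `r ≥ max(7M, √(12Λ)/|ω|, 1/(Mω²))`:
`(ω² − V(r))·(r² + a²)|R(r)|² + (Δ/(r² + a²))²|d/dr[(r² + a²)^{1/2} R](r)|² ≤ 2ω²`, i.e. the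
Sonin energy `E = (ω² − V)|u|² + |u′|²` of `u = (r² + a²)^{1/2} R` (`′ = d/dr*`) is at most its
value `2ω²` at `r* = +∞`: in the tortoise variable `E′ = −(dV/dr)(dr/dr*)|u|² ≥ 0` on the
(decrease) region `r ≥ 7M` of DRSR arXiv:1402.7034, §8.4, and `E → ω²·1 + ω²`
(`|u| → 1`, `|u′| → |ω|`, `V → 0`).
[cite: DafermosRodnianskiShlapentokhrothman2014, Prop. 8.4.1 (proof)] -/
theorem farEnergy_le {M a ω Λ : ℝ} {m : ℤ} (hM : 0 < M) (ha : |a| < M) (hω : ω ≠ 0)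
    (hadm : IsAdmissibleTriple a ω m Λ) {R : ℝ → ℂ}
    (hR : IsRadialTeukolskySolution M a 0 ω m (Λ - a ^ 2 * ω ^ 2) R)
    (hn : IsNormalisedInfinitySolution M 0 ω R) {r : ℝ}
    (hr : max (7 * M) (max (Real.sqrt (12 * Λ) / |ω|) (1 / (M * ω ^ 2))) ≤ r) :
    (ω ^ 2 - sepPotential M a ω m Λ r) * ((r ^ 2 + a ^ 2) * ‖R r‖ ^ 2) +
      (delta M a r / (r ^ 2 + a ^ 2)) ^ 2 *
        ‖deriv (fun s : ℝ ↦ ((Real.sqrt (s ^ 2 + a ^ 2) : ℝ) : ℂ) * R s) r‖ ^ 2 ≤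
      2 * ω ^ 2 := by
  have hsub : IsSubextremal M a := ha
  have h7 : 7 * M ≤ r := le_of_max_le_left hr
  -- Carter's variable: a tortoise radius `ρ` and `x₀` with `ρ x₀ = r`
  obtain ⟨hrp, -, -⟩ := far_region hM ha hω hadm hr
  obtain ⟨ρ, hρ⟩ := exists_isTortoiseRadius hsub
  obtain ⟨x₀, rfl⟩ := tortoise_exists_eq hρ hrp
  -- `u = √(ρ² + a²)·R ∘ ρ`, its tortoise derivative `u₁`, Carter's equation
  obtain ⟨u₁, u₂, hu⟩ := schrodingerForm hM ha hR hρ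
  -- the Sonin energy `E = (ω² − V(ρ y))|u y|² + |u₁ y|²` has `E′ = −V′(ρ y) ρ′(y) |u y|²`
  have hE : ∀ y, HasDerivAt (fun y ↦ (ω ^ 2 - sepPotential M a ω m Λ (ρ y)) *
        ‖((Real.sqrt (ρ y ^ 2 + a ^ 2) : ℝ) : ℂ) * R (ρ y)‖ ^ 2 + ‖u₁ y‖ ^ 2)
      (-(deriv (sepPotential M a ω m Λ) (ρ y) * (delta M a (ρ y) / (ρ y ^ 2 + a ^ 2))) *
        ‖((Real.sqrt (ρ y ^ 2 + a ^ 2) : ℝ) : ℂ) * R (ρ y)‖ ^ 2) y := fun y ↦ by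
    obtain ⟨h1, h2, h3, -⟩ := hu y
    have hA : ρ y ^ 2 + a ^ 2 ≠ 0 := (hρ.sq_add_sq_pos hsub y).ne'
    have hV := (hasDerivAt_sepPotential M a ω m Λ hA).differentiableAt.hasDerivAt
    rw [eq_neg_of_add_eq_zero_left h3, ← neg_mul] at h2
    exact Literature.Analysis.ODE.hasDerivAt_soninEnergy
      (φ := fun y ↦ ω ^ 2 - sepPotential M a ω m Λ (ρ y)) h1 h2
      ((hV.comp y (hρ.hasDerivAt y)).const_sub (ω ^ 2))
  -- `E′ ≥ 0` on `[x₀, ∞)`: there `ρ y ≥ ρ x₀ ≥ 7M`, so `V′(ρ y) < 0`, and `ρ′ > 0`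
  have hE' : ∀ y, x₀ ≤ y →
      0 ≤ -(deriv (sepPotential M a ω m Λ) (ρ y) * (delta M a (ρ y) / (ρ y ^ 2 + a ^ 2))) *
        ‖((Real.sqrt (ρ y ^ 2 + a ^ 2) : ℝ) : ℂ) * R (ρ y)‖ ^ 2 := fun y hy ↦ by
    have hy' : 7 * M ≤ ρ y := h7.trans ((hρ.strictMono hsub).monotone hy)
    have hd := deriv_sepPotential_neg_of_seven_mul_le hsub hadm hy'
    exact mul_nonneg (neg_nonneg.2 (mul_neg_of_neg_of_pos hd (hρ.deriv_pos hsub y)).le)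
      (sq_nonneg _)
  -- `E → (ω² − 0)·1² + |ω|² = 2ω²` at `+∞`
  have hlim : Tendsto (fun y ↦ (ω ^ 2 - sepPotential M a ω m Λ (ρ y)) *
        ‖((Real.sqrt (ρ y ^ 2 + a ^ 2) : ℝ) : ℂ) * R (ρ y)‖ ^ 2 + ‖u₁ y‖ ^ 2) atTop
      (𝓝 (2 * ω ^ 2)) := by
    have hV := tendsto_sepPotential_tortoise hM ha hadm hρ
    have hU : Tendsto (fun y ↦ ‖((Real.sqrt (ρ y ^ 2 + a ^ 2) : ℝ) : ℂ) * R (ρ y)‖) atTop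
        (𝓝 1) := by
      refine ((tendsto_norm_infinitySolution (a := a) hn).comp hρ.tendsto_atTop).congr
        fun y ↦ ?_
      rw [norm_mul, Complex.norm_of_nonneg (Real.sqrt_nonneg _)]
      rfl
    have hU₁ : Tendsto (fun y ↦ ‖u₁ y‖) atTop (𝓝 |ω|) := by
      refine ((tendsto_norm_deriv_infinitySolution hM ha hω hR hn).comp hρ.tendsto_atTop).congr
        fun y ↦ ?_
      rw [(hu y).2.2.2, norm_mul, Complex.norm_of_nonneg (hρ.deriv_pos hsub y).le]
      rfl
    have h := (((tendsto_const_nhds (x := ω ^ 2)).sub hV).mul (hU.pow 2)).add (hU₁.pow 2)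
    have e : (ω ^ 2 - 0) * 1 ^ 2 + |ω| ^ 2 = 2 * ω ^ 2 := by rw [sq_abs]; ring
    rw [e] at h
    exact h
  -- monotone + limit: `E(x₀) ≤ 2ω²`
  have key : (ω ^ 2 - sepPotential M a ω m Λ (ρ x₀)) *
        ‖((Real.sqrt (ρ x₀ ^ 2 + a ^ 2) : ℝ) : ℂ) * R (ρ x₀)‖ ^ 2 + ‖u₁ x₀‖ ^ 2 ≤
      2 * ω ^ 2 :=
    le_lim_of_deriv_nonneg (E := fun y ↦ (ω ^ 2 - sepPotential M a ω m Λ (ρ y)) *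
        ‖((Real.sqrt (ρ y ^ 2 + a ^ 2) : ℝ) : ℂ) * R (ρ y)‖ ^ 2 + ‖u₁ y‖ ^ 2)
      (fun y _ ↦ hE y) hE' hlim
  -- back to `R`: `|u x₀|² = (r² + a²)|R r|²`, `|u₁ x₀|² = (Δ/(r² + a²))² |d/dr[√(r² + a²) R]|²`
  have hA : 0 ≤ ρ x₀ ^ 2 + a ^ 2 := (hρ.sq_add_sq_pos hsub x₀).le
  rw [norm_mul, Complex.norm_of_nonneg (Real.sqrt_nonneg _), mul_pow, Real.sq_sqrt hA,
    (hu x₀).2.2.2, norm_mul, Complex.norm_of_nonneg (hρ.deriv_pos hsub x₀).le, mul_pow] at key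
  exact key

/-- **Far envelope of `R_{𝓘⁺}`.** For `0 < M`, `|a| < M`, `ω ≠ 0`, an admissible triple
`(ω, m, Λ)`, a classical solution `R` of the scalar radial Teukolsky ODE (`λ = Λ − a²ω²`)
normalised at `𝓘⁺` (TdC arXiv:1910.02854, Def. 2.3), and every
`r ≥ max(7M, √(12Λ)/|ω|, 1/(Mω²))`: `(r² + a²)|R(r)|² ≤ 4` and
`(Δ/(r² + a²))² |d/dr[(r² + a²)^{1/2} R](r)|² ≤ 2ω²`, i.e. `|u_𝓘|² ≤ 4`, `|u_𝓘′|² ≤ 2ω²` for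
`u_𝓘 = (r² + a²)^{1/2} R_𝓘`, `′ = d/dr*`. From `Costa2019.farEnergy_le`
(`(ω² − V)|u|² + |u′|² ≤ 2ω²`) and `ω² − V ≥ ω²/2` on this region ((someBoundS)/(decrease) of
DRSR arXiv:1402.7034, §8.4).
[cite: DafermosRodnianskiShlapentokhrothman2014, Prop. 8.4.1 (proof)] -/
theorem farEnvelope {M a ω Λ : ℝ} {m : ℤ} (hM : 0 < M) (ha : |a| < M) (hω : ω ≠ 0)
    (hadm : IsAdmissibleTriple a ω m Λ) {R : ℝ → ℂ}
    (hR : IsRadialTeukolskySolution M a 0 ω m (Λ - a ^ 2 * ω ^ 2) R)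
    (hn : IsNormalisedInfinitySolution M 0 ω R) {r : ℝ}
    (hr : max (7 * M) (max (Real.sqrt (12 * Λ) / |ω|) (1 / (M * ω ^ 2))) ≤ r) :
    (r ^ 2 + a ^ 2) * ‖R r‖ ^ 2 ≤ 4 ∧
    (delta M a r / (r ^ 2 + a ^ 2)) ^ 2 *
        ‖deriv (fun s : ℝ ↦ ((Real.sqrt (s ^ 2 + a ^ 2) : ℝ) : ℂ) * R s) r‖ ^ 2 ≤ 2 * ω ^ 2 := by
  have hω2 : 0 < ω ^ 2 := by positivity
  have key := farEnergy_le hM ha hω hadm hR hn hr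
  obtain ⟨-, hΦ, -⟩ := far_region hM ha hω hadm hr
  have hA0 : 0 ≤ (r ^ 2 + a ^ 2) * ‖R r‖ ^ 2 := by positivity
  have hB0 : 0 ≤ (delta M a r / (r ^ 2 + a ^ 2)) ^ 2 *
      ‖deriv (fun s : ℝ ↦ ((Real.sqrt (s ^ 2 + a ^ 2) : ℝ) : ℂ) * R s) r‖ ^ 2 := by positivity
  have h1 : ω ^ 2 / 2 * ((r ^ 2 + a ^ 2) * ‖R r‖ ^ 2) ≤
      (ω ^ 2 - sepPotential M a ω m Λ r) * ((r ^ 2 + a ^ 2) * ‖R r‖ ^ 2) :=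
    mul_le_mul_of_nonneg_right hΦ hA0
  have hΦ0 : 0 ≤ (ω ^ 2 - sepPotential M a ω m Λ r) * ((r ^ 2 + a ^ 2) * ‖R r‖ ^ 2) :=
    mul_nonneg (by linarith) hA0
  refine ⟨?_, by linarith⟩
  have h2 : ω ^ 2 * ((r ^ 2 + a ^ 2) * ‖R r‖ ^ 2) ≤ ω ^ 2 * 4 := by linarith
  exact le_of_mul_le_mul_left h2 hω2

end Costa2019

end Literature.Geometry.Lorentzian.Kerr

end
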